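import Literature.Computability.QuantumComplexity.CWrapFamily
import Literature.Computability.QuantumComplexity.CoinFamilyKernel
import HarnessLib

/-!
# Classical wrapping inside quantum search, IV: the output kernel of the wrapped family

Trunk `CryptoQuantFine`; fourth file of the construction discharging
`Literature.Computability.Cryptography.isQSolvable_classicalWrap` (plan in `CWrapLayout.lean`).
**The probability bound**: on input `x`, the wrapped family `CWrap.family` outputs, with
probability at least `F.kernelProb 0 (h x) (R (h x))` (the success probability of the given
family on `h x`), a string with prefix `g ⟨x, y⟩` for some `y ∈ R (h x)`
(`kernelProb_family_ge`). The proof is the standard deferred-measurement bookkeeping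
(Nielsen–Chuang 2010, §4.4; Bernstein–Vazirani 1997, §8), in the tree's matrix model:

* after stage 1 the register is the basis state `|w1 x⟩` (`CWrapFamily`); the quantum stage is,
  matrix-wise, the product of the copies `F.circ ℓ` placed on the pairwise disjoint blocks
  (`toMatrix_stageQ`, `WireConjugation.toMatrix_conj_mapWires`), so it produces the product state
  of the block states `U_ℓ |block ℓ of w1 x⟩` (`CircuitEmbedding`), block `|h x|` starting in
  `|h x, 0…0⟩` and the others in `|0…0⟩`;
* stage 2 permutes basis states (`perm2`); on a label agreeing with `w1 x` off the blocks it
  writes `gWrap g (prefix) = g ⟨x, y⟩` — `y` the first `|h x| + F.ancillas |h x|` wires of block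
  `|h x|` — onto the front wires (`isPrefix_perm2`: `gWrap_apply`, `liveLen_oneHot`, the
  read-out profile of the post-processor block);
* so the Born weight of the target event is at least that of "block `|h x|` reads a string of
  `R (h x)`" (`sum_ite_normSq_mulVec_of_perm`), which by the product structure
  (`sum_normSq_prodState_mul`, `sum_prod_mul_eq`, unit norm of the other blocks) and the padding
  (`sum_normSq_placeGate_castLE`) is exactly `F.kernelProb 0 (h x) (R (h x))`.

## References

* E. Bernstein, U. Vazirani, *Quantum complexity theory*, SIAM J. Comput. 26 (1997), §8.
* M. A. Nielsen, I. L. Chuang, *Quantum Computation and Quantum Information*, CUP 2010, §2.2.8,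
  §4.3, §4.4 (principle of deferred measurement).
-/

noncomputable section

namespace Literature.Computability.QuantumComplexity

namespace CWrap

open _root_.Computability Complexity Complexity.FinTM2Sim Turing Function RevSim RevClean Cryptography RevMux Matrix
open scoped BigOperators

variable (P : Params) (x : List Bool)

/-! ### The blocks -/

/-- Block `ℓ` as an embedding of `Pw` wires. [folklore] -/
def blockEmb (ℓ : Fin (Lh P.toLayout x.length + 1)) : Fin (Pw P.toLayout x.length) ↪ Fin (x.length + anc P x.length) :=
  ⟨fun i => ⟨blockW P.toLayout x.length ℓ i, blockW_fits (Nat.lt_succ_iff.1 ℓ.isLt) i.isLt⟩,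
    fun _ _ h => Fin.ext (blockW_injective P.toLayout x.length ℓ (congrArg Fin.val h))⟩

/-- `blockEmb` evaluated. [folklore] -/
@[simp] theorem blockEmb_apply_val (ℓ : Fin (Lh P.toLayout x.length + 1)) (i : Fin (Pw P.toLayout x.length)) :
    (blockEmb P x ℓ i : ℕ) = blockW P.toLayout x.length ℓ i := rfl

/-- **The blocks are pairwise disjoint.** [folklore] -/
theorem blockDisjoint : BlockDisjoint (blockEmb P x) := by
  intro ℓ ℓ' hne
  refine Set.disjoint_left.2 ?_
  rintro w ⟨i, rfl⟩ ⟨j, hj⟩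
  have h := congrArg Fin.val hj
  simp only [blockEmb_apply_val] at h
  exact hne (Fin.ext (blockW_inj P.toLayout j.isLt i.isLt h).1).symm

/-- The copy of length `ℓ`, padded to the block width. [folklore] -/
def Cpad (ℓ : Fin (Lh P.toLayout x.length + 1)) : QCircuit cliffordT (Pw P.toLayout x.length) :=
  mapWires (Fin.castLEEmb (le_Pw P.toLayout (Nat.lt_succ_iff.1 ℓ.isLt))) (P.F.circ ℓ)

/-- Swap–copy–swap of length `ℓ` is the padded copy embedded on block `ℓ`, matrix-wise. [folklore] -/
theorem toMatrix_conjBlock_eq (A : Language Bool) (ℓ : Fin (Lh P.toLayout x.length + 1)) :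
    (⟨conjGates P x.length ℓ ++ (copyGates P x.length ℓ ++ conjGates P x.length ℓ)⟩ :
        QCircuit cliffordT (x.length + anc P x.length)).toMatrix A =
      (mapWires (blockEmb P x ℓ) (Cpad P x ℓ)).toMatrix A := by
  have hℓ : (ℓ : ℕ) ≤ Lh P.toLayout x.length := Nat.lt_succ_iff.1 ℓ.isLt
  rw [toMatrix_conjBlock hℓ, toMatrix_mapWires, Cpad, toMatrix_mapWires, toMatrix_mapWires, placeGate_placeGate]
  congr 1
  ext i
  simp only [Function.Embedding.trans_apply, Fin.castLEEmb_apply, blockEmb_apply_val, Fin.val_castLE]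
  exact blockEmbLen_apply hℓ i

/-- **The quantum stage is the product of the padded copies on the blocks, matrix-wise.**
[cite: NielsenChuang2010, §4.3 (a gate on a subset of the wires is U ⊗ 1 up to the order of the factors)] -/
theorem toMatrix_stageQ (A : Language Bool) :
    (⟨stageQ P x.length⟩ : QCircuit cliffordT (x.length + anc P x.length)).toMatrix A =
      (⟨(List.finRange (Lh P.toLayout x.length + 1)).flatMap fun ℓ => (mapWires (blockEmb P x ℓ) (Cpad P x ℓ)).gates⟩ :
        QCircuit cliffordT (x.length + anc P x.length)).toMatrix A := by
  have hl : stageQ P x.length = (List.finRange (Lh P.toLayout x.length + 1)).flatMap fun ℓ : Fin _ =>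
      conjGates P x.length ℓ ++ (copyGates P x.length ℓ ++ conjGates P x.length ℓ) := by
    rw [stageQ, ← List.map_coe_finRange_eq_range, List.flatMap_map]
  rw [hl]
  exact toMatrix_flatMap_congr A _ _ _ fun ℓ _ => toMatrix_conjBlock_eq P x A ℓ

/-- The block states after the quantum stage. [folklore] -/
def blockState (ℓ : Fin (Lh P.toLayout x.length + 1)) : QReg (Pw P.toLayout x.length) → ℂ :=
  (Cpad P x ℓ).toMatrix 0 *ᵥ basisState (W1 P x ∘ blockEmb P x ℓ)

/-- **The state after the quantum stage is the product state of the block states** (off the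
blocks: `w1 x`). [cite: NielsenChuang2010, §2.1.7 eq. (2.45)] -/
theorem stageQ_mulVec_W1 :
    (⟨stageQ P x.length⟩ : QCircuit cliffordT (x.length + anc P x.length)).toMatrix 0 *ᵥ basisState (W1 P x) =
      prodState (blockEmb P x) (blockState P x) (W1 P x) := by
  rw [toMatrix_stageQ, basisState_eq_prodState (blockEmb P x) (W1 P x),
    toMatrix_flatMap_mapWires_mulVec_prodState 0 (blockDisjoint P x)]
  rfl

/-- **The final state**: stage 2 applied to the product state. [folklore] -/
theorem runOn_circ :
    (circ P x.length).runOn 0 (basisState (padInput x.get (anc P x.length))) =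
      (⟨stage2 P x.length⟩ : QCircuit cliffordT (x.length + anc P x.length)).toMatrix 0 *ᵥ
        prodState (blockEmb P x) (blockState P x) (W1 P x) := by
  rw [QCircuit.runOn, circ, show (⟨stage1 P x.length ++ (stageQ P x.length ++ stage2 P x.length)⟩ :
      QCircuit cliffordT (x.length + anc P x.length)) =
      (⟨stage1 P x.length⟩ : QCircuit cliffordT _).append ((⟨stageQ P x.length⟩ : QCircuit cliffordT _).append ⟨stage2 P x.length⟩)
      from rfl, QCircuit.toMatrix_append, QCircuit.toMatrix_append, ← Matrix.mulVec_mulVec, ← Matrix.mulVec_mulVec,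
    toMatrix_stage1_mulVec_pad, stageQ_mulVec_W1]

/-! ### Stage 2 on the labels of the support -/

section Stage2

variable {P x}

/-- A label of the support: it agrees with `w1 x` off the blocks. [folklore] -/
def Agrees (z : QReg (x.length + anc P x.length)) : Prop := ∀ w, OffBlocks (blockEmb P x) w → z w = W1 P x w

/-- Wires below `baseB` are off the blocks. [folklore] -/
theorem offBlocks_of_lt_baseB {w : Fin (x.length + anc P x.length)} (hw : (w : ℕ) < baseB P.toLayout x.length) :
    OffBlocks (blockEmb P x) w := by
  rintro ℓ ⟨i, rfl⟩
  exact absurd hw (Nat.not_lt.2 (baseB_le_blockW _ _ _ _))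

/-- Wires from `D` on are off the blocks. [folklore] -/
theorem offBlocks_of_D_le {w : Fin (x.length + anc P x.length)} (hw : D P.toLayout x.length ≤ w) :
    OffBlocks (blockEmb P x) w := by
  rintro ℓ ⟨i, h⟩
  have := blockW_lt_D P.toLayout (Nat.lt_succ_iff.1 ℓ.isLt) i.isLt
  rw [← h] at hw
  exact absurd hw (Nat.not_le.2 this)

/-- The prefix content (the data of the post-processor block) of a label. [folklore] -/
def pre (z : QReg (x.length + anc P x.length)) : List Bool := (List.ofFn z).take (D P.toLayout x.length)

/-- Length of the prefix content. [folklore] -/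
theorem length_pre (z : QReg (x.length + anc P x.length)) : (pre z).length = D P.toLayout x.length := by
  rw [pre, List.length_take, List.length_ofFn]
  exact Nat.min_eq_left (by rw [n_add_anc]; exact (D_lt_widthG P x.length).le)

/-- Entries of the prefix content. [folklore] -/
theorem getD_pre (z : QReg (x.length + anc P x.length)) {i : ℕ} (hi : i < D P.toLayout x.length) :
    (pre z).getD i false = z ⟨i, by rw [n_add_anc]; exact hi.trans (D_lt_widthG P x.length)⟩ := by
  rw [pre, List.getD_eq_getElem?_getD, List.getElem?_take, if_pos hi, List.getElem?_ofFn]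
  simp [show i < x.length + anc P x.length by rw [n_add_anc]; exact hi.trans (D_lt_widthG P x.length)]

/-- **On the support, the lifted label is the prefix content followed by zeros.** [folklore] -/
theorem liftW_eq_strW_pre {z : QReg (x.length + anc P x.length)} (hz : Agrees z) : liftW z = strW (pre z) := by
  funext i
  unfold liftW strW
  by_cases hi : i < x.length + anc P x.length
  · rw [dif_pos hi]
    by_cases hiD : i < D P.toLayout x.length
    · rw [getD_pre z hiD]
    · rw [List.getD_eq_getElem?_getD, List.getElem?_eq_none (by rw [length_pre]; omega)]
      have hoff : OffBlocks (blockEmb P x) ⟨i, hi⟩ := offBlocks_of_D_le (Nat.not_lt.1 hiD)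
      rw [hz _ hoff]
      exact w1_of_D_le P x (Nat.not_lt.1 hiD)
  · rw [dif_neg hi, List.getD_eq_getElem?_getD, List.getElem?_eq_none (by rw [length_pre]; rw [n_add_anc] at hi; have := D_lt_widthG P x.length; omega)]
    rfl

/-- The output of the wrapped post-processor on the prefix content. [folklore] -/
def out (z : QReg (x.length + anc P x.length)) : List Bool := gWrap P.toLayout P.g (pre z ++ vg x.length)

/-- The machine of the post-processor halts on the prefix content within the time bound of the
block. [folklore] -/
theorem hMg_pre (z : QReg (x.length + anc P x.length)) :
    P.Mg.OutputsWithin (pre z ++ vg x.length) (out z) (Tn P.eg ((pre z).length + (vg x.length).length)) := by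
  have h := P.hMg (pre z ++ vg x.length)
  rwa [List.length_append] at h

/-- **The post-processor block on a support label**: data kept, read-out of `out z` behind.
[cite: Shor1997, §3 p.8 (compute F(x) keeping x, copy, undo)] -/
theorem clEval_progG_pre {z : QReg (x.length + anc P x.length)} (hz : Agrees z) :
    clEval (progG P x.length) (liftW z) = fun i =>
      if i < D P.toLayout x.length then (pre z).getD i false else readOut P.eg P.Mg (nG P.toLayout x.length) (out z) i := by
  rw [liftW_eq_strW_pre hz, progG]
  have h := clEval_cleanOps (e := P.eg) (M := P.Mg) (pre z) (vg x.length) (out z) (hMg_pre z)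
  rw [length_pre] at h
  rw [h]
  rfl

/-- `out z` fits into the read-out cells: `|out z| < Pg`. [folklore] -/
theorem length_out_lt (z : QReg (x.length + anc P x.length)) : (out z).length < Pg P x.length := by
  have h := (length_lt_JJ_of_outputsWithin (e := P.eg) (M := P.Mg) (u := pre z ++ vg x.length) (n := nG P.toLayout x.length)
    (by rw [List.length_append, length_pre]; rfl) (by have := hMg_pre z; rwa [length_pre] at this)).1
  exact h

/-- **Stage 2 on a support label writes `out z` onto the front wires.** [folklore] -/
theorem perm2_apply_of_lt {z : QReg (x.length + anc P x.length)} (hz : Agrees z) {j : ℕ} (hj : j < (out z).length)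
    (hjN : j < x.length + anc P x.length) : perm2 P x.length z ⟨j, hjN⟩ = (out z)[j] := by
  have hjP : j < Pg P x.length := hj.trans (length_out_lt z)
  rw [perm2_apply]
  change clEval (progG P x.length ++ progOut P x.length) (liftW z) j = _
  rw [clEval_append, clEval_progG_pre hz, progOut]
  -- the hypotheses of the swap layer
  have h1 : ((outPairs P x.length).map Prod.fst).Nodup := by
    rw [outPairs, List.map_map]
    exact List.nodup_range.map_on fun a _ b _ h => (resW_inj h).1
  have h2 : ((outPairs P x.length).map Prod.snd).Nodup := by
    rw [outPairs, List.map_map]; simpa [Function.comp_def] using List.nodup_range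
  have h12 : ∀ q ∈ outPairs P x.length, ∀ q' ∈ outPairs P x.length, q.1 ≠ q'.2 := by
    intro q hq q' hq'
    simp only [outPairs, List.mem_map, List.mem_range] at hq hq'
    obtain ⟨i, -, rfl⟩ := hq; obtain ⟨i', hi', rfl⟩ := hq'
    exact (Nat.ne_of_lt (lt_of_lt_of_le hi' (Pg_le_tWg P x.length i))).symm
  obtain ⟨hsnd, -, -⟩ := clEval_swapOps (outPairs P x.length) h1 h2 h12
    (fun i => if i < D P.toLayout x.length then (pre z).getD i false else readOut P.eg P.Mg (nG P.toLayout x.length) (out z) i)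
  have hmem : (tWg P x.length j, j) ∈ outPairs P x.length := List.mem_map.2 ⟨j, List.mem_range.2 hjP, rfl⟩
  rw [hsnd _ hmem]
  simp only
  have hge : ¬ tWg P x.length j < D P.toLayout x.length :=
    Nat.not_lt.2 ((D_lt_nG _ _).le.trans ((le_NN (e := P.eg) (M := P.Mg) _).trans (NN_le_resW _ _ _)))
  rw [if_neg hge, tWg, readOut_resW hjP]
  exact outBit_symTrue_eq (e := P.eg) (u := pre z ++ vg x.length) (by rw [List.length_append, length_pre]; try rfl)
    (hMg_pre z |> fun h => by rwa [length_pre] at h) hj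

/-- **Hence `out z` is a prefix of the measured string** of the final label. [folklore] -/
theorem out_isPrefix_ofFn_perm2 {z : QReg (x.length + anc P x.length)} (hz : Agrees z) :
    out z <+: List.ofFn (perm2 P x.length z) := by
  rw [List.prefix_iff_eq_take]
  apply List.ext_getElem
  · rw [List.length_take, List.length_ofFn]
    exact (Nat.min_eq_left ((length_out_lt z).le.trans (by rw [n_add_anc]; exact Pg_le_widthG P x.length))).symm
  · intro j hj hj'
    rw [List.getElem_take, List.getElem_ofFn]
    exact (perm2_apply_of_lt hz hj _).symm

/-! #### Reading the prefix content -/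

/-- The input part of the prefix content is `x`. [folklore] -/
theorem take_pre_eq {z : QReg (x.length + anc P x.length)} (hz : Agrees z) : (pre z).take x.length = x := by
  apply List.ext_getElem
  · rw [List.length_take, length_pre]; exact Nat.min_eq_left (le_D _ _)
  · intro i hi hi'
    rw [List.length_take, length_pre, Nat.min_eq_left (le_D _ _)] at hi
    have hiD : i < D P.toLayout x.length := lt_of_lt_of_le hi' (le_D _ _)
    rw [List.getElem_take, ← List.getD_eq_getElem _ false (by rw [length_pre]; exact hiD), getD_pre z hiD,
      hz _ (offBlocks_of_lt_baseB (lt_of_lt_of_le hi' ((le_widthH _ _).trans (widthH_lt_baseB _ _).le)))]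
    change w1 P x i = x[i]
    rw [w1_of_lt P x hi', List.getD_eq_getElem _ _ hi']

/-- The flag part of the prefix content is one-hot at `|h x|`, so the live length read is `|h x|`.
[folklore] -/
theorem liveLen_pre_eq {z : QReg (x.length + anc P x.length)} (hz : Agrees z) :
    liveLen (((pre z).drop (widthH P.toLayout x.length)).take (Lh P.toLayout x.length + 1)) = (P.h x).length := by
  have hLD : widthH P.toLayout x.length + (Lh P.toLayout x.length + 1) ≤ D P.toLayout x.length := by unfold D baseB; omega
  refine liveLen_oneHot (length_h_le_Lh P.toLayout x) _ ?_ (fun ℓ hℓ => ?_)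
  · rw [List.length_take, List.length_drop, length_pre]; exact Nat.min_eq_left (by omega)
  · rw [List.length_take, List.length_drop, length_pre] at hℓ
    have hℓ' : ℓ ≤ Lh P.toLayout x.length := by omega
    have hiD : widthH P.toLayout x.length + ℓ < D P.toLayout x.length := by omega
    rw [List.getElem_take, List.getElem_drop, ← List.getD_eq_getElem _ false (by rw [length_pre]; exact hiD), getD_pre z hiD,
      hz _ (offBlocks_of_lt_baseB (flagW_lt_baseB _ hℓ'))]
    exact w1_flagW P x hℓ'

/-- The live length as a block index. [folklore] -/
def lsFin : Fin (Lh P.toLayout x.length + 1) := ⟨(P.h x).length, Nat.lt_succ_of_le (length_h_le_Lh P.toLayout x)⟩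

/-- The copy length fits into the block width. [folklore] -/
theorem ls_fits : (P.h x).length + P.F.ancillas (P.h x).length ≤ Pw P.toLayout x.length := le_Pw P.toLayout (length_h_le_Lh P.toLayout x)

/-- The live block part of the prefix content is the first `|h x| + F.ancillas |h x|` wires of
block `|h x|` of the label. [folklore] -/
theorem block_pre_eq (z : QReg (x.length + anc P x.length)) :
    ((pre z).drop (blockW P.toLayout x.length (P.h x).length 0)).take ((P.h x).length + P.F.ancillas (P.h x).length) =
      List.ofFn ((z ∘ blockEmb P x lsFin) ∘ Fin.castLEEmb ls_fits) := by
  have hbD : blockW P.toLayout x.length (P.h x).length 0 + ((P.h x).length + P.F.ancillas (P.h x).length) ≤ D P.toLayout x.length := by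
    have h1 := ls_fits (P := P) (x := x)
    have h2 : (P.h x).length * Pw P.toLayout x.length ≤ Lh P.toLayout x.length * Pw P.toLayout x.length :=
      Nat.mul_le_mul_right _ (length_h_le_Lh P.toLayout x)
    have h3 : (Lh P.toLayout x.length + 1) * Pw P.toLayout x.length = Lh P.toLayout x.length * Pw P.toLayout x.length + Pw P.toLayout x.length := by ring
    unfold blockW D; omega
  apply List.ext_getElem
  · rw [List.length_take, List.length_drop, length_pre, List.length_ofFn]; exact Nat.min_eq_left (by omega)
  · intro i hi hi'
    rw [List.length_ofFn] at hi'
    have hiD : blockW P.toLayout x.length (P.h x).length 0 + i < D P.toLayout x.length := by omega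
    rw [List.getElem_take, List.getElem_drop, ← List.getD_eq_getElem _ false (by rw [length_pre]; exact hiD), getD_pre z hiD,
      List.getElem_ofFn]
    simp only [Function.comp_apply]
    congr 1

/-- **The output on a support label is `g ⟨x, y⟩`** with `y` the live block content. [folklore] -/
theorem out_eq {z : QReg (x.length + anc P x.length)} (hz : Agrees z) :
    out z = P.g (boolPair x (List.ofFn ((z ∘ blockEmb P x lsFin) ∘ Fin.castLEEmb ls_fits))) := by
  rw [out, gWrap_apply, liveLen_pre_eq hz, take_pre_eq hz, block_pre_eq z]

end Stage2

/-! ### The kernel bound -/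

/-- The content of block `|h x|` after stage 1, on the first `|h x| + F.ancillas |h x|` wires, is
the padded input `|h x, 0…0⟩` of the copy. [folklore] -/
theorem W1_block_castLE :
    (W1 P x ∘ blockEmb P x lsFin) ∘ Fin.castLEEmb (ls_fits (P := P) (x := x)) = padInput (P.h x).get (P.F.ancillas (P.h x).length) := by
  funext i
  simp only [Function.comp_apply, W1]
  change w1 P x (blockW P.toLayout x.length (P.h x).length (Fin.castLEEmb _ i)) = _
  rw [show ((Fin.castLEEmb (ls_fits (P := P) (x := x)) i : Fin _) : ℕ) = i from rfl,
    w1_blockW P x (length_h_le_Lh P.toLayout x) (lt_of_lt_of_le i.isLt ls_fits)]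
  simp only [decide_true, Bool.true_and]
  by_cases hi : (i : ℕ) < (P.h x).length
  · have e : padInput (P.h x).get (P.F.ancillas (P.h x).length) i = (P.h x).get ⟨i, hi⟩ :=
      (congrArg (padInput (P.h x).get (P.F.ancillas (P.h x).length)) (show i = Fin.castAdd _ ⟨i, hi⟩ from Fin.ext rfl)).trans
        (Fin.append_left _ _ _)
    rw [e, List.getD_eq_getElem _ _ hi, List.get_eq_getElem]
  · have hi' : (i : ℕ) - (P.h x).length < P.F.ancillas (P.h x).length := by omega
    have e : padInput (P.h x).get (P.F.ancillas (P.h x).length) i = false :=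
      (congrArg (padInput (P.h x).get (P.F.ancillas (P.h x).length))
        (show i = Fin.natAdd _ ⟨(i : ℕ) - (P.h x).length, hi'⟩ from Fin.ext (by simp; omega))).trans (Fin.append_right _ _ _)
    rw [e, List.getD_eq_getElem?_getD, List.getElem?_eq_none (Nat.not_lt.1 hi)]
    rfl

/-- The other wires of block `|h x|` after stage 1 are `0`. [folklore] -/
theorem W1_block_of_le (i : Fin (Pw P.toLayout x.length)) (hi : (P.h x).length + P.F.ancillas (P.h x).length ≤ (i : ℕ)) :
    (W1 P x ∘ blockEmb P x lsFin) i = false := by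
  simp only [Function.comp_apply, W1]
  change w1 P x (blockW P.toLayout x.length (P.h x).length i) = false
  rw [w1_blockW P x (length_h_le_Lh P.toLayout x) i.isLt]
  simp only [decide_true, Bool.true_and, List.getD_eq_getElem?_getD]
  rw [List.getElem?_eq_none (by omega)]
  rfl

/-- Every block state is a unit vector. [folklore] -/
theorem normSq_blockState (ℓ : Fin (Lh P.toLayout x.length + 1)) : ∑ v, ‖blockState P x ℓ v‖ ^ 2 = 1 := by
  have h := normSq_mulVec_of_mem_unitaryGroup
    (QCircuit.toMatrix_mem_unitaryGroup_holds cliffordT_isUnitary_holds 0 (Cpad P x ℓ)) (basisState (W1 P x ∘ blockEmb P x ℓ))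
  rw [normSq_basisState] at h
  exact h

/-- **The kernel bound.** On input `x`, the wrapped family outputs a string with a prefix
`g ⟨x, y⟩`, `y ∈ R (h x)`, with probability at least the success probability of the given family
on `h x`. [cite: BernsteinVazirani1997, §8 (classical computation inside quantum machines)] -/
theorem kernelProb_family_ge (R : List Bool → Set (List Bool)) :
    P.F.kernelProb 0 (P.h x) (R (P.h x)) ≤
      (family P).kernelProb 0 x {z | ∃ y ∈ R (P.h x), P.g (boolPair x y) <+: z} := by
  classical
  set T : Set (List Bool) := {z | ∃ y ∈ R (P.h x), P.g (boolPair x y) <+: z} with hT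
  -- the wrapped family's kernel as a Born sum, pushed back along stage 2
  have hK : (family P).kernelProb 0 x T =
      ∑ z : QReg (x.length + anc P x.length), if List.ofFn (perm2 P x.length z) ∈ T then
        ‖prodState (blockEmb P x) (blockState P x) (W1 P x) z‖ ^ 2 else 0 := by
    change ((((circ P x.length).outputPMF 0 x.get).map List.ofFn).toOuterMeasure T).toReal = _
    rw [toReal_outputPMF_map_ofFn, runOn_circ]
    exact sum_ite_normSq_mulVec_of_perm (perm2 P x.length) (toMatrix_stage2_mulVec_basisState P 0 x.length) _ _
  -- the given family's kernel as a Born sum of the live block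
  set U := (P.F.circ (P.h x).length).toMatrix 0 with hU
  have hF : P.F.kernelProb 0 (P.h x) (R (P.h x)) =
      ∑ u : QReg ((P.h x).length + P.F.ancillas (P.h x).length), if List.ofFn u ∈ R (P.h x) then
        ‖U u (padInput (P.h x).get (P.F.ancillas (P.h x).length))‖ ^ 2 else 0 := by
    change ((((P.F.circ (P.h x).length).outputPMF 0 (P.h x).get).map List.ofFn).toOuterMeasure (R (P.h x))).toReal = _
    rw [toReal_outputPMF_map_ofFn]
    refine Finset.sum_congr rfl fun u _ => ?_
    rw [QCircuit.runOn, mulVec_basisState]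
  -- the indicator of the live block event
  let G : QReg (Pw P.toLayout x.length) → ℝ := fun v => if List.ofFn (v ∘ Fin.castLEEmb (ls_fits (P := P) (x := x))) ∈ R (P.h x) then 1 else 0
  -- (1) pointwise: on the support, the live block event implies the target event
  have h1 : ∀ z : QReg (x.length + anc P x.length),
      ‖prodState (blockEmb P x) (blockState P x) (W1 P x) z‖ ^ 2 * G (z ∘ blockEmb P x lsFin) ≤
        (if List.ofFn (perm2 P x.length z) ∈ T then ‖prodState (blockEmb P x) (blockState P x) (W1 P x) z‖ ^ 2 else 0) := by
    intro z
    by_cases hz : Agrees z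
    · by_cases hG : List.ofFn ((z ∘ blockEmb P x lsFin) ∘ Fin.castLEEmb ls_fits) ∈ R (P.h x)
      · have hTz : List.ofFn (perm2 P x.length z) ∈ T := by
          refine ⟨_, hG, ?_⟩
          rw [← out_eq hz]
          exact out_isPrefix_ofFn_perm2 hz
        simp only [G, hG, if_true, mul_one, hTz]
        exact le_rfl
      · simp only [G, hG, if_false, mul_zero]
        split_ifs <;> positivity
    · -- off the support the product state vanishes
      have h0 : prodState (blockEmb P x) (blockState P x) (W1 P x) z = 0 := by
        have hz' : ¬ (∀ w, OffBlocks (blockEmb P x) w → z w = W1 P x w) := hz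
        rw [prodState_apply, if_neg hz', zero_mul]
      simp [h0]
  -- (2) the left-hand side of (1), summed, is the given family's kernel
  have h2 : (∑ z : QReg (x.length + anc P x.length),
      ‖prodState (blockEmb P x) (blockState P x) (W1 P x) z‖ ^ 2 * G (z ∘ blockEmb P x lsFin)) =
        P.F.kernelProb 0 (P.h x) (R (P.h x)) := by
    rw [sum_normSq_prodState_mul (blockDisjoint P x) (blockState P x) (W1 P x) (fun y => G (y lsFin)),
      sum_prod_mul_eq (fun ℓ v => ‖blockState P x ℓ v‖ ^ 2) lsFin (fun ℓ _ => normSq_blockState P x ℓ) G, hF]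
    -- the live block: padded copy on the padded input
    have hφ : ∀ v, ‖blockState P x lsFin v‖ ^ 2 * G v =
        if List.ofFn (v ∘ Fin.castLEEmb (ls_fits (P := P) (x := x))) ∈ R (P.h x) then
          ‖(placeGate (Fin.castLEEmb ls_fits) U *ᵥ basisState (W1 P x ∘ blockEmb P x lsFin)) v‖ ^ 2 else 0 := by
      intro v
      simp only [G, mul_ite, mul_one, mul_zero, blockState, Cpad, toMatrix_mapWires, lsFin, hU]
    simp_rw [hφ]
    rw [sum_normSq_placeGate_castLE ls_fits U (W1 P x ∘ blockEmb P x lsFin)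
      (fun u : QReg ((P.h x).length + P.F.ancillas (P.h x).length) => List.ofFn u ∈ R (P.h x))]
    refine Finset.sum_congr rfl fun u _ => ?_
    rw [W1_block_castLE]
  -- assemble
  rw [← h2, hK]
  exact Finset.sum_le_sum fun z _ => h1 z

end CWrap

end Literature.Computability.QuantumComplexity

end
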